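import Literature.Probability.RandomPlanarGeometry.SAWCountZdSymbolTwoPartsRecurrence
import Literature.Probability.RandomPlanarGeometry.SAWCountZdSymbolFourthLowerCount
import Literature.Probability.RandomPlanarGeometry.SAWCountZdSymbolThirdCoefficient
import HarnessLib

/-!
# THE LOWEST CORNER OF EVERY LAYER: `M_j(m, m−3) = (m−3)·2^{m−2}·Σ_e 2^e C(m−4, e) T(m−4−e, m−j−2)` for all `j + 2 ≤ m`

Topic `Literature/Probability/RandomPlanarGeometry` (the «SYMBOL POLYNOMIALITY» programme; on `SAWCountZdSymbolTwoPartsRecurrence.lean` (a-p1 g27: `assocStirling`,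
`card_twoParts_eq_assocStirling`), `SAWCountZdSymbolSecondLowerCount.lean` (a-p1 g26: the (A, B, ρ) data `abData`, ★★ `card_goodParts_eq_card_abData`, `card_outerPos`),
`SAWCountZdSymbolBlockData.lean` (`card_shapeClass_topVec`), λ1 `SAWCountZdSymbolTopShapes.lean` (`exists_eq_topVec_of_mem_shapeClass`, `topVec_injOn`), and for the
cross-checks `SAWCountZdSymbolThirdCoefficient.lean` (`thirdShapeSumLow`), `SAWCountZdSymbolFourthLowerCount.lean` (`fourthShapeSumLow`), `SAWCountZdSymbolSecondCoefficient.lean`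
(`secondShapeSumBelow`)).

PRINTED CONTEXT (locators only). Madras–Slade (1993) §1.1 eq. (1.1.8) p. 5, Definition 1.2.4, §1.2 p. 10; Clisby–Liang–Slade (2007) §3.3 eqs. (29)/(31); Charalambides (2018)
Ch. 2 Exercise 32 (associated Stirling numbers of the second kind `T(n, k)`).

THE THEOREM. In the census matrix `M_j(u, b)` of the `j`-th `1/d`-symbol the `ℓ`-th layer (`b = 2j − 2 − ℓ`) has corners `u = 2j, …, 2j + 1 − ℓ`; its LOWEST corner
`u = m = 2j + 1 − ℓ` carries `m − 3` breaks, i.e. (λ1) exactly the one-block classes `topVec m p`, `p ≤ m − 4`, each of size `#goodParts(m, j, p)·2^{m−2}` (block data),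
`#goodParts = #abData` ((A, B, ρ) coordinates, `j + 2 ≤ m`) and — HERE — ★★ `card_disjPairs_eq`: the disjoint pairs `(A, B)` inside `n` points with `#A + #B = e` number
`2^e·C(n, e)`; ★★★ `card_abData_eq_sum`: **`#abData(m, j, p) = Σ_{e=0}^{m−4} 2^e·C(m−4, e)·T(m−4−e, m−j−2)`** with `T` the associated Stirling numbers; hence ★★★
`card_shapeClass_topVec_eq_sum` and ★★★ `lowestShapeSum_eq`: **`M_j(m, m−3) = (m − 3)·(Σ_e 2^e C(m−4,e) T(m−4−e, m−j−2))·2^{m−2}` for every `j + 2 ≤ m`, `4 ≤ m`** — the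
lowest corner of EVERY layer in closed form modulo the triangular recurrence of `T`: `ℓ = 2, 3, 4` re-derive 5b's `V'_j`, W (`thirdShapeSumLow`), F (`fourthShapeSumLow`)
(`lowestShapeSum_eq_secondShapeSumBelow/_thirdShapeSumLow/_fourthShapeSumLow`, and `lowestShapeSum_values_known`: `896, 30720; 192, 10560, 582400; 1024, 100608, 8544256`),
and `ℓ = 5, 6` are NEW: ★ `lowestShapeSum_values_fifth`: `M_j(2j−4, 2j−7) = 5120, 847616, 107412480, 12822261760` (`j = 6…9`) and `M_j(2j−5, 2j−8) = 24576,
6598656, 1218723840` (`j = 7, 8, 9`) — `107412480 = M₈(12,9)` and `6598656 = M₈(11,8)` are in the lane's `j = 8` census (FINDING §18); `j = 9` is a blind prediction. Tool notion (the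
lane's): `lowestShapeSum`.

THIS FILE (lane «pcv-sawmu», a-p1 g27; all PROVED, standard axioms): ★★ `card_disjPairs_eq`, ★★★ `card_abData_eq_sum`, ★★★ `card_shapeClass_topVec_eq_sum`, `lowestShapeSum`,
★★★ `lowestShapeSum_eq`, `lowestShapeSum_eq_secondShapeSumBelow`, `lowestShapeSum_eq_thirdShapeSumLow`, `lowestShapeSum_eq_fourthShapeSumLow`, `lowestShapeSum_values_known`,
★ `lowestShapeSum_values_fifth`.
[cite: MadrasSlade1993, §1.1 eq. (1.1.8) p. 5; Definition 1.2.4; §1.2 (p. 10)] [cite: ClisbyLiangSlade2007, §3.3 eqs. (29)/(31)]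
[cite: Charalambides2018, Ch. 2 Exercise 32 (associated Stirling numbers of the second kind)]

Provenance: lane «pcv-sawmu», a-p1 g27 (2026-08-28).
-/

open Finset
open scoped BigOperators
open Literature.Probability.LatticeModels
open Literature.Probability.RandomPlanarGeometry.SAW
open Literature.Probability.Percolation

namespace Literature.Probability.RandomPlanarGeometry.SAW.Zd

namespace WordTypes

variable {m : ℕ}

/-! ### Disjoint pairs by total size -/

/-- ★★ The disjoint pairs `(A, B)` inside `O` with `#A + #B = e` number `2^e·C(#O, e)` (choose `A ∪ B`, then `A ⊆ A ∪ B`).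
[cite: Charalambides2018, Ch. 2 Exercise 32; lane lemma] -/
theorem card_disjPairs_eq (O : Finset (Fin m)) (e : ℕ) :
    (((O.powerset ×ˢ O.powerset).filter (fun AB : Finset (Fin m) × Finset (Fin m) => Disjoint AB.1 AB.2)).filter
        (fun AB => AB.1.card + AB.2.card = e)).card = 2 ^ e * O.card.choose e := by
  classical
  have htarget : ((O.powersetCard e).sigma fun S => S.powerset).card = 2 ^ e * O.card.choose e := by
    rw [Finset.card_sigma, Finset.sum_const_nat (m := 2 ^ e) (fun S hS => by rw [Finset.card_powerset, (Finset.mem_powersetCard.1 hS).2]),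
      Finset.card_powersetCard, mul_comm]
  rw [← htarget]
  refine Finset.card_nbij' (fun AB => ⟨AB.1 ∪ AB.2, AB.1⟩) (fun d => (d.2, d.1 \ d.2)) (fun AB hAB => ?_) (fun d hd => ?_) (fun AB hAB => ?_) (fun d hd => ?_)
  · rw [Finset.mem_coe, Finset.mem_filter, Finset.mem_filter, Finset.mem_product, Finset.mem_powerset, Finset.mem_powerset] at hAB
    obtain ⟨⟨⟨hA, hB⟩, hd⟩, he⟩ := hAB
    rw [Finset.mem_coe, Finset.mem_sigma, Finset.mem_powersetCard, Finset.mem_powerset]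
    exact ⟨⟨Finset.union_subset hA hB, by rw [Finset.card_union_of_disjoint hd, he]⟩, Finset.subset_union_left⟩
  · rw [Finset.mem_coe, Finset.mem_sigma, Finset.mem_powersetCard, Finset.mem_powerset] at hd
    obtain ⟨⟨hS, hSe⟩, hA⟩ := hd
    rw [Finset.mem_coe, Finset.mem_filter, Finset.mem_filter, Finset.mem_product, Finset.mem_powerset, Finset.mem_powerset]
    refine ⟨⟨⟨hA.trans hS, Finset.sdiff_subset.trans hS⟩, Finset.disjoint_sdiff⟩, ?_⟩
    dsimp only
    rw [Finset.card_sdiff_of_subset hA]; have := Finset.card_le_card hA; omega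
  · rw [Finset.mem_coe, Finset.mem_filter, Finset.mem_filter] at hAB
    obtain ⟨⟨-, hd⟩, -⟩ := hAB
    simp only [Finset.union_sdiff_cancel_left hd]
  · rw [Finset.mem_coe, Finset.mem_sigma, Finset.mem_powersetCard, Finset.mem_powerset] at hd
    obtain ⟨-, hA⟩ := hd
    simp only [Finset.union_sdiff_of_subset hA]

/-! ### The (A, B, ρ) count in general -/

/-- ★★★ THE (A, B, ρ) COUNT FOR EVERY `m ≥ j + 2`: `#abData(m, j, p) = Σ_{e=0}^{m−4} 2^e·C(m−4, e)·T(m−4−e, m−j−2)` — group the disjoint pairs `(A, B)` by `e = #A + #B`; the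
rest is partitioned into `m − j − 2` blocks of size `≥ 2` in `T(m−4−e, m−j−2)` ways. [cite: MadrasSlade1993, Definition 1.2.4]
[cite: Charalambides2018, Ch. 2 Exercise 32; lane theorem] -/
theorem card_abData_eq_sum {j p : ℕ} (hp : p + 4 ≤ m) :
    (abData m j p hp).card = ∑ e ∈ Finset.range (m - 4 + 1), 2 ^ e * (m - 4).choose e * assocStirling (m - 4 - e) (m - j - 2) := by
  classical
  unfold abData
  rw [Finset.card_sigma]
  set O := outerPos m p hp with hO
  set D := (O.powerset ×ˢ O.powerset).filter (fun AB : Finset (Fin m) × Finset (Fin m) => Disjoint AB.1 AB.2) with hD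
  have hOc : O.card = m - 4 := card_outerPos hp
  have hmemD : ∀ AB ∈ D, AB.1 ⊆ O ∧ AB.2 ⊆ O ∧ Disjoint AB.1 AB.2 := by
    intro AB hAB
    rw [hD, Finset.mem_filter, Finset.mem_product, Finset.mem_powerset, Finset.mem_powerset] at hAB
    exact ⟨hAB.1.1, hAB.1.2, hAB.2⟩
  have hval : ∀ AB ∈ D, (twoParts (O \ (AB.1 ∪ AB.2)) (m - j - 2)).card = assocStirling (m - 4 - (AB.1.card + AB.2.card)) (m - j - 2) := by
    intro AB hAB
    obtain ⟨hA, hB, hd⟩ := hmemD AB hAB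
    exact card_twoParts_eq_assocStirling _ _ _ (by rw [Finset.card_sdiff_of_subset (Finset.union_subset hA hB), Finset.card_union_of_disjoint hd, hOc])
  have hmaps : ∀ AB ∈ D, AB.1.card + AB.2.card ∈ Finset.range (m - 4 + 1) := by
    intro AB hAB
    obtain ⟨hA, hB, hd⟩ := hmemD AB hAB
    have := Finset.card_le_card (Finset.union_subset hA hB)
    rw [Finset.card_union_of_disjoint hd, hOc] at this
    rw [Finset.mem_range]; omega
  rw [Finset.sum_congr rfl hval, ← Finset.sum_fiberwise_of_maps_to hmaps]
  refine Finset.sum_congr rfl fun e _ => ?_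
  rw [Finset.sum_congr rfl (g := fun _ => assocStirling (m - 4 - e) (m - j - 2)) (fun AB hAB => by rw [(Finset.mem_filter.1 hAB).2]), Finset.sum_const, smul_eq_mul,
    hD, card_disjPairs_eq O e, hOc]

/-- ★★★ THE ONE-BLOCK CLASS COUNT FOR EVERY `m ≥ j + 2`: `#shapeClass j m (topVec m p) = (Σ_e 2^e C(m−4,e) T(m−4−e, m−j−2))·2^{m−2}` (independent of `p`).
[cite: MadrasSlade1993, Definition 1.2.4] [cite: Charalambides2018, Ch. 2 Exercise 32; lane theorem] -/
theorem card_shapeClass_topVec_eq_sum {j p : ℕ} (hp : p + 4 ≤ m) (hmj : j + 2 ≤ m) :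
    (shapeClass j m (topVec m p)).card = (∑ e ∈ Finset.range (m - 4 + 1), 2 ^ e * (m - 4).choose e * assocStirling (m - 4 - e) (m - j - 2)) * 2 ^ (m - 2) := by
  rw [card_shapeClass_topVec hp, card_goodParts_eq_card_abData hp hmj, card_abData_eq_sum hp]

/-! ### The lowest corner of every layer -/

open Classical in
/-- The LOWEST-CORNER SUM `M_j(m, m−3) = Σ_{A valid on m letters, breaks A = m − 3} #shapeClass_j(m, A)` (one run of four on `m` letters; `m = 2j − 1, 2j − 2, 2j − 3, …` are the
lowest corners of the layers `2, 3, 4, …`). [cite: MadrasSlade1993, Definition 1.2.4; lane tool notion] -/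
noncomputable def lowestShapeSum (j m : ℕ) : ℕ :=
  ∑ A : Fin m → Bool, if AdjValid A ∧ breaks A = m - 3 then (shapeClass j m A).card else 0

open Classical in
/-- ★★★ THE LOWEST CORNER OF EVERY LAYER: for `j + 2 ≤ m` and `4 ≤ m`, `M_j(m, m−3) = (m − 3)·(Σ_{e=0}^{m−4} 2^e C(m−4, e) T(m−4−e, m−j−2))·2^{m−2}`.
[cite: MadrasSlade1993, §1.1 eq. (1.1.8) p. 5; Definition 1.2.4] [cite: ClisbyLiangSlade2007, §3.3 eqs. (29)/(31)] [cite: Charalambides2018, Ch. 2 Exercise 32; lane theorem] -/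
theorem lowestShapeSum_eq {j : ℕ} (hmj : j + 2 ≤ m) (hm : 4 ≤ m) :
    lowestShapeSum j m = (m - 3) * ((∑ e ∈ Finset.range (m - 4 + 1), 2 ^ e * (m - 4).choose e * assocStirling (m - 4 - e) (m - j - 2)) * 2 ^ (m - 2)) := by
  unfold lowestShapeSum
  have hval : ∀ p ∈ Finset.range (m - 3),
      (if AdjValid (topVec m p) ∧ breaks (topVec m p) = m - 3 then (shapeClass j m (topVec m p)).card else 0) =
        (∑ e ∈ Finset.range (m - 4 + 1), 2 ^ e * (m - 4).choose e * assocStirling (m - 4 - e) (m - j - 2)) * 2 ^ (m - 2) := by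
    intro p hp
    rw [Finset.mem_range] at hp
    have hp4 : p + 4 ≤ m := by omega
    rw [if_pos ⟨adjValid_topVec hp4, breaks_topVec hp4⟩, card_shapeClass_topVec_eq_sum hp4 hmj]
  have hvan : ∀ A ∈ (Finset.univ : Finset (Fin m → Bool)), A ∉ (Finset.range (m - 3)).image (topVec m) →
      (if AdjValid A ∧ breaks A = m - 3 then (shapeClass j m A).card else 0) = 0 := by
    intro A _ hA
    split_ifs with h
    · by_contra hne
      obtain ⟨κ, hκ⟩ := Finset.card_pos.1 (Nat.pos_of_ne_zero hne)
      obtain ⟨p, hp4, rfl⟩ := exists_eq_topVec_of_mem_shapeClass (by rw [h.2]; omega) hκ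
      exact hA (Finset.mem_image.2 ⟨p, Finset.mem_range.2 (by omega), rfl⟩)
    · rfl
  have hinj : Set.InjOn (topVec m) ↑(Finset.range (m - 3)) := by
    intro p hp p' hp' h
    rw [Finset.mem_coe, Finset.mem_range] at hp hp'
    exact topVec_injOn (by omega) (by omega) h
  rw [← Finset.sum_subset (Finset.subset_univ _) hvan, Finset.sum_image hinj, Finset.sum_congr rfl hval, Finset.sum_const, Finset.card_range, smul_eq_mul]

/-! ### Cross-checks with the layers already in the tree, and the fifth and sixth layers -/

/-- Layer 2: `lowestShapeSum j (2j−1) = V'_j` (`secondShapeSumBelow`). [cite: MadrasSlade1993, Definition 1.2.4; lane plumbing] -/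
theorem lowestShapeSum_eq_secondShapeSumBelow (j : ℕ) : lowestShapeSum j (2 * j - 1) = secondShapeSumBelow j := by
  unfold lowestShapeSum secondShapeSumBelow
  exact Finset.sum_congr rfl fun A _ => by rw [show 2 * j - 1 - 3 = 2 * j - 4 by omega]

/-- Layer 3: `lowestShapeSum j (2j−2) = W'_j` (`thirdShapeSumLow`). [cite: MadrasSlade1993, Definition 1.2.4; lane plumbing] -/
theorem lowestShapeSum_eq_thirdShapeSumLow (j : ℕ) : lowestShapeSum j (2 * j - 2) = thirdShapeSumLow j := by
  unfold lowestShapeSum thirdShapeSumLow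
  exact Finset.sum_congr rfl fun A _ => by rw [show 2 * j - 2 - 3 = 2 * j - 5 by omega]

/-- Layer 4: `lowestShapeSum j (2j−3) = fourthShapeSumLow j`. [cite: MadrasSlade1993, Definition 1.2.4; lane plumbing] -/
theorem lowestShapeSum_eq_fourthShapeSumLow (j : ℕ) : lowestShapeSum j (2 * j - 3) = fourthShapeSumLow j := by
  unfold lowestShapeSum fourthShapeSumLow
  exact Finset.sum_congr rfl fun A _ => by rw [show 2 * j - 3 - 3 = 2 * j - 6 by omega]

/-- The known corners re-derived from the general formula: `V'_4, V'_5 = 896, 30720`; `W'_4, W'_5, W'_6 = 192, 10560, 582400`; `M_j(2j−3, 2j−6) = 1024, 100608, 8544256` (`j = 5, 6, 7`).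
[cite: MadrasSlade1993, Definition 1.2.4; lane theorem] -/
theorem lowestShapeSum_values_known :
    (lowestShapeSum 4 7 = 896 ∧ lowestShapeSum 5 9 = 30720) ∧ (lowestShapeSum 4 6 = 192 ∧ lowestShapeSum 5 8 = 10560 ∧ lowestShapeSum 6 10 = 582400) ∧
      (lowestShapeSum 5 7 = 1024 ∧ lowestShapeSum 6 9 = 100608 ∧ lowestShapeSum 7 11 = 8544256) := by
  refine ⟨⟨?_, ?_⟩, ⟨?_, ?_, ?_⟩, ⟨?_, ?_, ?_⟩⟩ <;> rw [lowestShapeSum_eq (by norm_num) (by norm_num)] <;> decide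

/-- ★ THE FIFTH AND SIXTH LAYERS' LOWEST CORNERS (new): `M_j(2j−4, 2j−7) = 5120, 847616, 107412480, 12822261760` for `j = 6, 7, 8, 9` and `M_j(2j−5, 2j−8) = 24576,
6598656, 1218723840` for `j = 7, 8, 9` (`j = 8`: ≡ FINDING §18's `M₈(12,9)`, `M₈(11,8)`). [cite: MadrasSlade1993, Definition 1.2.4; lane theorem] -/
theorem lowestShapeSum_values_fifth :
    (lowestShapeSum 6 8 = 5120 ∧ lowestShapeSum 7 10 = 847616 ∧ lowestShapeSum 8 12 = 107412480 ∧ lowestShapeSum 9 14 = 12822261760) ∧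
      (lowestShapeSum 7 9 = 24576 ∧ lowestShapeSum 8 11 = 6598656 ∧ lowestShapeSum 9 13 = 1218723840) := by
  refine ⟨⟨?_, ?_, ?_, ?_⟩, ⟨?_, ?_, ?_⟩⟩ <;> rw [lowestShapeSum_eq (by norm_num) (by norm_num)] <;> decide

end WordTypes

end Literature.Probability.RandomPlanarGeometry.SAW.Zd
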